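import Literature.MathematicalPhysics.QuantumFieldTheory.ConstructiveQFTBalabanRG
import Mathlib.Analysis.Calculus.ParametricIntegral
import Mathlib.Analysis.Calculus.Deriv.Star
import Mathlib.Analysis.Calculus.BumpFunction.FiniteDimension
import Mathlib.Analysis.Calculus.BumpFunction.Normed
import Mathlib.Analysis.Complex.RealDeriv
import Mathlib.Analysis.SpecialFunctions.Trigonometric.Deriv
import Mathlib.MeasureTheory.Group.Integral
import Mathlib.MeasureTheory.Measure.Haar.InnerProductSpace
import HarnessLib

/-!
# The schematic rendering `MagnenRivasseauSeneorYM4` is vacuous: an artificial witness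

This file proves the proposition
`Literature.MathematicalPhysics.QuantumFieldTheory.MagnenRivasseauSeneorYM4` (inventory item
constructive-qft.S21 as *rendered* in `ConstructiveQFTBalabanRG`) by an explicit artificial
witness, as the sorry-free theorem
`Literature.MathematicalPhysics.QuantumFieldTheory.magnenRivasseauSeneorYM4_of_artificialWitness`.
The name is deliberately NOT the canonical discharge name `MagnenRivasseauSeneorYM4_holds`
(review of p29606): the theorem is a VACUITY FINDING about the v0 statement — it must not make
the ledger record Magnen–Rivasseau–Sénéor's theorem as formalised. The named fact stays
undischarged; the operator should re-render S21 (pin `ref κ` to the regularised axial-gauge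
Gaussian measure of MRS §1) before anyone attempts a genuine discharge.

**What is and is not proved.** The intended content of S21 is Magnen–Rivasseau–Sénéor,
*Construction of `YM₄` with an infrared cutoff*, CMP 155 (1993) 325–383, Thm. 1: continuum `SU(2)`
Yang–Mills in a finite volume, regularised axial gauge, as a limit of UV-regularised functional
integrals with a convergent expansion. Nothing of that analysis is formalised here. The statement
file renders S21 *schematically*: the regularisation is a hypothesis structure
`AxialGaugeYMRegularisation Λ g` whose reference measures `ref κ` are free data, constrained only
to be atomless, to have Gibbs tilts (by `exp(-(g⁻² S_Λ + local counterterms))`) that are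
probability measures, and to have divergent expected action; the target asks for a limit family
`S` with `S 2 ≠ 0` satisfying the global `SU(2)` Slavnov identities. Its own docstring warns that
the rendering "fixes the *shape* of S21, not its analytic content" and "presumably admits
artificial witnesses". This file confirms that warning by an explicit witness, which records
inside Lean that `(h : MagnenRivasseauSeneorYM4)` carries no information downstream; a faithful
statement would have to pin `ref κ` to the regularised axial-gauge Gaussian measure of MRS §1,
which is not available over Mathlib at the pin.

## The witness (namespace `…QuantumFieldTheory.MRSWitness`)

* Frames and configurations. `B = (0, C₃, C₂, 0)` with `C₂ = (0,1;-1,0)`, `C₃ = (i,0;0,-i)`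
  (`[C₃, C₂] ≠ 0`); for `U ∈ SU(2)` the constant connection `conn (U B U⁻¹) : x ↦ (v ↦ ∑ μ, v μ •
  U B_μ U⁻¹)` is smooth, `𝔰𝔲(2)`-valued and axial (`B 0 = 0`), giving `Ψ : SU(2) → AxialConfig`.
  `P := Haar ∘ Ψ⁻¹`, `ref κ := (κ + 1) · P`, zero counterterms.
* Action. `F_{conn T} = [T_u, T_v]` (A14 `curvature`; `fderiv` of a constant vanishes), so
  `ymDensity (conn T) = ρ T` is constant in `x`, invariant under `T ↦ U T U⁻¹` (unitary
  invariance of the Frobenius norm, prelude `Matrix.frobenius_norm_unitaryGroup_mul`) and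
  `ρ B > 0`; hence `S_Λ ≡ sΛ L = L⁴ ρ B > 0` on the range of `Ψ`. Consequently the tilt is
  `P`-a.e. constant, every Gibbs law is `P`, and `𝔼_{ref κ} S_Λ = (κ + 1) sΛ L → ∞`.
* Almost-everywhere bookkeeping. The range of `Ψ` is identified with a measurable set written with
  countably many scalar conditions (values on a countable dense set, continuity), so
  `∀ᵐ A ∂P, A ∈ range Ψ` (`ae_range_Ψ`); the fibres of `Ψ` are `{U, -U}` (`Ψ_fibre`), which are
  Haar-null because `1 ∈ SU(2)` is not isolated (`nhdsNE_one_neBot`, Mathlib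
  `IsHaarMeasure.nullSingletonClass`), so every `ref κ` is atomless.
* Schwinger functions. `fieldMonomial n ι F (conn T) = (∫ F) ∏ⱼ (T_{μⱼ})_{pⱼqⱼ}`, so the
  regularised Schwinger functions are, for every `κ`, `Sw n ι F = mom ι · ∫ F` with the Haar
  moments `mom ι = ∫ ∏ⱼ (U B_{μⱼ} U⁻¹)_{pⱼqⱼ} dU`; `Sw n ι` is the tempered distribution
  `mom ι • SchwartzMap.integralCLM ℂ volume`. Non-degeneracy: `∑_{pq} mom ((1,p,q),(1,q,p)) =
  ∫ tr (U C₃ U⁻¹)² dU = -2`, tested against a bump function.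
* Slavnov identities. For constant `ω = C ∈ 𝔰𝔲(2)` the `∂ω` terms vanish and the identity
  reduces to `(∫ F) · Wsum ι C = 0`, where `Wsum ι C = -∫ ad_C(∏ⱼ …) dU`. The vanishing of the
  Haar integral of an `ad_C`-derivative (`integral_ward_eq_zero`) is proved by left invariance of
  Haar measure along the explicit one-parameter subgroups `θ ↦ cos θ · 1 + sin θ · Cₖ`
  (`curve_mem`) and differentiation under the integral sign
  (`hasDerivAt_integral_of_dominated_loc_of_deriv_le`, domination by compactness of
  `[-1,1] × SU(2)`), for the three generators `C₁, C₂, C₃`, and extended to `𝔰𝔲(2)` by real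
  linearity (`su2_decomp`).

No new named facts, no instances on Mathlib types, no `sorry`.

## References

* J. Magnen, V. Rivasseau, R. Sénéor, *Construction of `YM₄` with an infrared cutoff*, CMP 155
  (1993) 325–383, Thm. 1 [MagnenRivasseauSeneor1993] — the intended (not formalised) content.
* Unitary invariance of Haar measure and of the Frobenius norm: standard (Bröcker–tom Dieck I §5;
  Horn–Johnson Thm. 2.2.2), via Mathlib and the `YangMillsClassical` prelude.
-/

noncomputable section

open MeasureTheory Filter Topology Finset
open scoped SchwartzMap Matrix.Norms.Frobenius ComplexConjugate ENNReal

namespace Literature.MathematicalPhysics.QuantumFieldTheory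

open QuantumLattice

namespace MRSWitness

/-- Euclidean `ℝ⁴`. [folklore] -/
abbrev E4 : Type := EuclideanSpace ℝ (Fin 4)
/-- `M₂(ℂ)`. [folklore] -/
abbrev M2 : Type := Matrix (Fin 2) (Fin 2) ℂ
/-- `SU(2)`. [folklore] -/
abbrev SU2 : Type := ↥(Matrix.specialUnitaryGroup (Fin 2) ℂ)

section FibreType
variable (E 𝔸 : Type*) [NormedAddCommGroup E] [InnerProductSpace ℝ E] [NormedRing 𝔸]
  [NormedAlgebra ℝ 𝔸]
/-- The fibre `E →L[ℝ] 𝔸` of `Connection E 𝔸`, spelled through the same instance path as the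
prelude (so that `Connection E 𝔸 = E → Fibre E 𝔸` syntactically). [folklore] -/
abbrev Fibre : Type _ := E →L[ℝ] 𝔸
end FibreType

/-! #### Three generators of `𝔰𝔲(2)` -/

/-- The generator `C₁ = (0, i; i, 0)` of `𝔰𝔲(2)` (`i σ₁`). [folklore] -/
def C1 : M2 := !![0, Complex.I; Complex.I, 0]
/-- The generator `C₂ = (0, 1; -1, 0)` of `𝔰𝔲(2)` (`i σ₂`). [folklore] -/
def C2 : M2 := !![0, 1; -1, 0]
/-- The generator `C₃ = (i, 0; 0, -i)` of `𝔰𝔲(2)` (`i σ₃`). [folklore] -/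
def C3 : M2 := !![Complex.I, 0; 0, -Complex.I]

/-- `C₁ ∈ 𝔰𝔲(2)`. [folklore] -/
lemma C1_mem : C1 ∈ suAlgebra 2 := by
  rw [mem_suAlgebra_iff]
  refine ⟨?_, ?_⟩
  · ext i j; fin_cases i <;> fin_cases j <;> simp [C1, Matrix.conjTranspose]
  · simp [C1, Matrix.trace_fin_two]

/-- `C₂ ∈ 𝔰𝔲(2)`. [folklore] -/
lemma C2_mem : C2 ∈ suAlgebra 2 := by
  rw [mem_suAlgebra_iff]
  refine ⟨?_, ?_⟩
  · ext i j; fin_cases i <;> fin_cases j <;> simp [C2, Matrix.conjTranspose]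
  · simp [C2, Matrix.trace_fin_two]

/-- `C₃ ∈ 𝔰𝔲(2)`. [folklore] -/
lemma C3_mem : C3 ∈ suAlgebra 2 := by
  rw [mem_suAlgebra_iff]
  refine ⟨?_, ?_⟩
  · ext i j; fin_cases i <;> fin_cases j <;> simp [C3, Matrix.conjTranspose]
  · simp [C3, Matrix.trace_fin_two]

/-- `C₃` and `C₂` do not commute. [folklore] -/
lemma C3_mul_C2_sub_ne : C3 * C2 - C2 * C3 ≠ 0 := by
  intro h
  have := congrFun (congrFun h 0) 1
  simp [C3, C2] at this

/-- `C₃² = -1`. [folklore] -/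
lemma C3_mul_C3 : C3 * C3 = -1 := by
  ext i j; fin_cases i <;> fin_cases j <;> simp [C3]

/-- `tr C₃² = -2`. [folklore] -/
lemma trace_C3_mul_C3 : (C3 * C3).trace = -2 := by
  rw [C3_mul_C3, Matrix.trace_neg, Matrix.trace_one]
  norm_num

/-- The frame `B = (0, C3, C2, 0)`. [folklore] -/
def B : Fin 4 → M2 := ![0, C3, C2, 0]

/-- `B 0 = 0` (axial gauge). [folklore] -/
@[simp] lemma B_zero : B 0 = 0 := rfl
/-- `B 1 = C₃`. [folklore] -/
@[simp] lemma B_one : B 1 = C3 := rfl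
/-- `B 2 = C₂`. [folklore] -/
@[simp] lemma B_two : B 2 = C2 := rfl
/-- `B 3 = 0`. [folklore] -/
@[simp] lemma B_three : B 3 = 0 := rfl

/-- The frame `B` is `𝔰𝔲(2)`-valued. [folklore] -/
lemma B_mem (μ : Fin 4) : B μ ∈ suAlgebra 2 := by
  fin_cases μ
  · exact Submodule.zero_mem _
  · exact C3_mem
  · exact C2_mem
  · exact Submodule.zero_mem _

/-- Unitary conjugation of a frame. [folklore] -/
def conjT (g : M2) (T : Fin 4 → M2) : Fin 4 → M2 := fun μ => g * T μ * star g

/-- Pointwise formula for the conjugated frame. [folklore] -/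
@[simp] lemma conjT_apply (g : M2) (T : Fin 4 → M2) (μ : Fin 4) :
    conjT g T μ = g * T μ * star g := rfl

/-- Conjugation of frames is an action. [folklore] -/
lemma conjT_mul (g h : M2) (T : Fin 4 → M2) : conjT (g * h) T = conjT g (conjT h T) := by
  funext μ
  simp only [conjT, star_mul, Matrix.mul_assoc]

/-- Conjugation by `1` is the identity. [folklore] -/
lemma conjT_one (T : Fin 4 → M2) : conjT 1 T = T := by
  funext μ; simp [conjT]

/-- The conjugated frame `U B U⁻¹`. [folklore] -/
def conjB (U : SU2) : Fin 4 → M2 := conjT U.1 B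

/-- `U* U = 1` for `U ∈ SU(2)`. [folklore] -/
lemma star_mul_self (U : SU2) : star U.1 * U.1 = 1 := U.prop.1.1
/-- `U U* = 1` for `U ∈ SU(2)`. [folklore] -/
lemma mul_star_self (U : SU2) : U.1 * star U.1 = 1 := U.prop.1.2

/-- `𝔰𝔲(2)` is stable under conjugation by `SU(2)` (adjoint action). [folklore] -/
lemma conj_mem_suAlgebra (U : SU2) {M : M2} (hM : M ∈ suAlgebra 2) :
    U.1 * M * star U.1 ∈ suAlgebra 2 := by
  rw [mem_suAlgebra_iff] at hM ⊢
  refine ⟨?_, ?_⟩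
  · rw [← Matrix.star_eq_conjTranspose, star_mul, star_mul, star_star,
      Matrix.star_eq_conjTranspose M, hM.1]
    simp [Matrix.mul_assoc]
  · rw [Matrix.trace_mul_cycle, star_mul_self, Matrix.one_mul, hM.2]

/-- The conjugated frame is `𝔰𝔲(2)`-valued. [folklore] -/
lemma conjB_mem (U : SU2) (μ : Fin 4) : conjB U μ ∈ suAlgebra 2 :=
  conj_mem_suAlgebra U (B_mem μ)

/-- Pointwise formula for the conjugated frame `U B U⁻¹`. [folklore] -/
lemma conjB_apply (U : SU2) (μ : Fin 4) : conjB U μ = U.1 * B μ * star U.1 := rfl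

/-- The conjugated frame has vanishing time component (axial gauge). [folklore] -/
@[simp] lemma conjB_zero (U : SU2) : conjB U 0 = 0 := by simp [conjB_apply]

/-- `(VU) B (VU)⁻¹ = V (U B U⁻¹) V⁻¹`. [folklore] -/
lemma conjB_mul (V U : SU2) : conjB (V * U) = conjT V.1 (conjB U) := by
  simp only [conjB, Submonoid.coe_mul, conjT_mul]

/-- `U ↦ U B U⁻¹` is continuous. [folklore] -/
lemma continuous_conjB : Continuous conjB := by
  refine continuous_pi fun μ => ?_
  simp only [conjB_apply]
  exact (continuous_subtype_val.mul continuous_const).mul continuous_subtype_val.star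

/-! #### Constant connections with a given frame -/

/-- `v ↦ ∑ μ, v μ • T μ`. [folklore] -/
def frame (T : Fin 4 → M2) : Fibre E4 M2 where
  toFun v := ∑ μ, v μ • T μ
  map_add' v w := by simp [add_smul, Finset.sum_add_distrib]
  map_smul' c v := by simp [Finset.smul_sum, smul_smul]
  cont := by fun_prop

/-- The constant connection with frame `T`. [folklore] -/
def conn (T : Fin 4 → M2) : Connection E4 M2 := fun _ => frame T

/-- Pointwise formula `conn T x v = ∑ μ, v μ • T μ`. [folklore] -/
lemma conn_apply (T : Fin 4 → M2) (x v : E4) : conn T x v = ∑ μ, v μ • T μ := rfl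

/-- On the standard basis vector `e_μ` the constant connection returns `T μ`. [folklore] -/
@[simp] lemma conn_single (T : Fin 4 → M2) (x : E4) (μ : Fin 4) :
    conn T x (EuclideanSpace.single μ 1) = T μ := by
  rw [conn_apply]
  simp [ite_smul]

/-- `conn` is additive in the frame. [folklore] -/
lemma conn_add (T T' : Fin 4 → M2) (x v : E4) : conn (T + T') x v = conn T x v + conn T' x v := by
  simp [conn_apply, smul_add, Finset.sum_add_distrib]

/-- `conn` is homogeneous in the frame. [folklore] -/
lemma conn_smul (c : ℝ) (T : Fin 4 → M2) (x v : E4) : conn (c • T) x v = c • conn T x v := by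
  simp [conn_apply, Finset.smul_sum, smul_comm c]

/-- `conn` intertwines conjugation of the frame with conjugation of the values. [folklore] -/
lemma conn_conjT (g : M2) (T : Fin 4 → M2) (x v : E4) :
    conn (conjT g T) x v = g * conn T x v * star g := by
  simp [conn_apply, Finset.mul_sum, Finset.sum_mul, Matrix.mul_assoc]

/-- `T ↦ conn T 0` is linear, hence continuous. [folklore] -/
def frameₗ : (Fin 4 → M2) →ₗ[ℝ] Fibre E4 M2 where
  toFun T := conn T 0
  map_add' T T' := ContinuousLinearMap.ext fun v => conn_add T T' 0 v
  map_smul' c T := ContinuousLinearMap.ext fun v => conn_smul c T 0 v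

/-- The frame-to-fibre map is continuous (linear on a finite-dimensional space). [folklore] -/
lemma continuous_conn_zero : Continuous fun T : Fin 4 → M2 => conn T 0 :=
  frameₗ.continuous_of_finiteDimensional

/-- Constant connections are smooth. [folklore] -/
lemma isSmoothConnection_conn (T : Fin 4 → M2) : IsSmoothConnection (conn T) :=
  contDiff_const

/-- A constant connection with `𝔰𝔲(2)`-valued frame is `𝔰𝔲(2)`-valued. [folklore] -/
lemma isValuedIn_conn {T : Fin 4 → M2} (hT : ∀ μ, T μ ∈ suAlgebra 2) :
    (conn T).IsValuedIn (suAlgebra 2) := by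
  intro x v
  rw [conn_apply]
  exact Submodule.sum_mem _ fun μ _ => Submodule.smul_mem _ _ (hT μ)

/-- A constant connection whose frame has no time component is in axial gauge. [folklore] -/
lemma isAxialGauge_conn {T : Fin 4 → M2} (hT : T 0 = 0) :
    IsAxialGauge axialDirection (conn T) := by
  intro x
  rw [axialDirection, conn_single, hT]

/-- The configuration attached to an admissible frame. [folklore] -/
def cfg (T : Fin 4 → M2) (hT : ∀ μ, T μ ∈ suAlgebra 2) (h0 : T 0 = 0) : AxialConfig :=
  ⟨conn T, isSmoothConnection_conn T, isValuedIn_conn hT, isAxialGauge_conn h0⟩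

/-- The witness map `SU(2) → AxialConfig`, `U ↦ (x ↦ ∑ μ, v μ • U B_μ U⁻¹)`. [folklore] -/
def Ψ (U : SU2) : AxialConfig := cfg (conjB U) (conjB_mem U) (conjB_zero U)

/-- The underlying connection of the witness configuration. [folklore] -/
@[simp] lemma coe_Ψ (U : SU2) : ((Ψ U : AxialConfig) : Connection E4 M2) = conn (conjB U) := rfl

/-- The witness map is measurable for the cylinder σ-algebra. [folklore] -/
lemma measurable_Ψ : Measurable Ψ := by
  refine Measurable.subtype_mk ?_
  refine measurable_pi_lambda _ fun x => ?_
  have hc : Continuous fun U : SU2 => conn (conjB U) x :=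
    continuous_conn_zero.comp continuous_conjB
  exact hc.measurable

/-! #### Scalar coordinates of a configuration -/

/-- The entries of the frame read off at the origin. [folklore] -/
def ent (A : AxialConfig) (μ : Fin 4) (a b : Fin 2) : ℂ :=
  (A : Connection E4 M2) 0 (EuclideanSpace.single μ 1) a b

/-- The same data as a frame of matrices. [folklore] -/
def Zf (A : AxialConfig) : Fin 4 → M2 := fun μ => Matrix.of (ent A μ)

/-- The frame read off at the origin, as values of the connection. [folklore] -/
lemma Zf_apply (A : AxialConfig) (μ : Fin 4) :
    Zf A μ = (A : Connection E4 M2) 0 (EuclideanSpace.single μ 1) := by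
  ext a b; rfl

/-- The frame of the witness configuration `Ψ U` is `U B U⁻¹`. [folklore] -/
@[simp] lemma Zf_Ψ (U : SU2) : Zf (Ψ U) = conjB U := by
  funext μ; rw [Zf_apply, coe_Ψ, conn_single]

/-- Matrix entries of field values are measurable functions of the configuration. [folklore] -/
lemma measurable_eval_entry (x v : E4) (a b : Fin 2) :
    Measurable fun A : AxialConfig => (A : Connection E4 M2) x v a b := by
  have hc : Continuous fun T : Fibre E4 M2 => T v a b :=
    ((continuous_id (X := Fibre E4 M2)).clm_apply continuous_const).matrix_elem a b
  exact hc.measurable.comp (AxialConfig.measurable_apply x)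

/-- The entry map is measurable. [folklore] -/
lemma measurable_ent : Measurable ent :=
  measurable_pi_lambda _ fun μ => measurable_pi_lambda _ fun a =>
    measurable_pi_lambda _ fun b => measurable_eval_entry 0 (EuclideanSpace.single μ 1) a b

/-- The structure set: configurations that are constant with an `SU(2)`-conjugate of `B` as
frame, written with countably many measurable conditions. [folklore] -/
def Rset (D : Set E4) : Set AxialConfig :=
  {A | ent A ∈ Set.range fun U : SU2 => fun μ a b => conjB U μ a b} ∩
    ⋂ q ∈ D, ⋂ ν : Fin 4, ⋂ a : Fin 2, ⋂ b : Fin 2,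
      {A | (A : Connection E4 M2) q (EuclideanSpace.single ν 1) a b = ent A ν a b}

/-- The set of entry data of conjugated frames is compact (continuous image of `SU(2)`). [folklore] -/
lemma isCompact_range_entries :
    IsCompact (Set.range fun U : SU2 => fun μ a b => conjB U μ a b) :=
  isCompact_range (continuous_pi fun μ => continuous_pi fun a => continuous_pi fun b =>
    ((continuous_apply μ).comp continuous_conjB).matrix_elem a b)

/-- The structure set is measurable (countably many measurable conditions). [folklore] -/
lemma measurableSet_Rset {D : Set E4} (hD : D.Countable) : MeasurableSet (Rset D) := by
  refine (isCompact_range_entries.isClosed.measurableSet.preimage measurable_ent).inter ?_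
  refine MeasurableSet.biInter hD fun q _ => MeasurableSet.iInter fun ν =>
    MeasurableSet.iInter fun a => MeasurableSet.iInter fun b => ?_
  exact measurableSet_eq_fun (measurable_eval_entry q _ a b) (measurable_eval_entry 0 _ a b)

/-- Witness configurations belong to the structure set. [folklore] -/
lemma Ψ_mem_Rset (D : Set E4) (U : SU2) : Ψ U ∈ Rset D := by
  refine ⟨⟨U, ?_⟩, ?_⟩
  · funext μ a b
    simp [ent, conn_single]
  · simp only [Set.mem_iInter, Set.mem_setOf_eq]
    intro q _ ν a b
    simp [ent, conn_single]

/-- Two continuous linear maps on `ℝ⁴` agreeing on the standard basis are equal. [folklore] -/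
lemma fibre_ext {S T : Fibre E4 M2} (h : ∀ ν, S (EuclideanSpace.single ν 1) =
    T (EuclideanSpace.single ν 1)) : S = T := by
  refine ContinuousLinearMap.ext fun v => ?_
  have hv : v = ∑ ν, v ν • EuclideanSpace.single ν (1 : ℝ) := by
    simpa using ((EuclideanSpace.basisFun (Fin 4) ℝ).sum_repr v).symm
  rw [hv, map_sum, map_sum]
  exact Finset.sum_congr rfl fun ν _ => by rw [map_smul, map_smul, h ν]

/-- A configuration in the structure set is a witness configuration (continuity and density). [folklore] -/
lemma eq_Ψ_of_mem_Rset {D : Set E4} (hDd : Dense D) {A : AxialConfig} (hA : A ∈ Rset D) :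
    ∃ U, A = Ψ U := by
  obtain ⟨⟨U, hU⟩, hA⟩ := hA
  simp only [Set.mem_iInter, Set.mem_setOf_eq] at hA
  refine ⟨U, AxialConfig.ext ?_⟩
  refine Continuous.ext_on hDd A.continuous (Ψ U).continuous fun q hq => ?_
  rw [coe_Ψ]
  refine fibre_ext fun ν => ?_
  rw [conn_single]
  ext a b
  rw [hA q hq ν a b]
  exact (congrFun (congrFun (congrFun hU ν) a) b).symm

/-! #### Haar measure on `SU(2)` -/

/-- Normalised Haar measure on `SU(2)`. [folklore] -/
def μH : Measure SU2 := haarProbability SU2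

/-- `μH` is a probability measure (`GaugeGroups`). [folklore] -/
instance : IsProbabilityMeasure μH := by
  unfold μH; infer_instance

/-- `μH` is left invariant (Mathlib `haarMeasure`). [folklore] -/
instance : μH.IsMulLeftInvariant := by
  unfold μH haarProbability; infer_instance

/-- `μH` is a Haar measure (Mathlib `haarMeasure`). [folklore] -/
instance : μH.IsHaarMeasure := by
  unfold μH haarProbability; infer_instance

/-- Continuous functions on the compact group are Haar integrable. [folklore] -/
lemma integrable_of_continuous {f : SU2 → ℂ} (hf : Continuous f) : Integrable f μH :=
  hf.integrable_of_hasCompactSupport (HasCompactSupport.of_compactSpace f)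

/-- The one-parameter family `cos θ • 1 + sin θ • C`. [folklore] -/
def curve (C : M2) (θ : ℝ) : M2 := (Real.cos θ : ℂ) • (1 : M2) + (Real.sin θ : ℂ) • C

/-- Its derivative. [folklore] -/
def dcurve (C : M2) (θ : ℝ) : M2 := (-Real.sin θ : ℂ) • (1 : M2) + (Real.cos θ : ℂ) • C

/-- Entries of the curve. [folklore] -/
lemma curve_apply (C : M2) (θ : ℝ) (a b : Fin 2) :
    curve C θ a b = (Real.cos θ : ℂ) * (1 : M2) a b + (Real.sin θ : ℂ) * C a b := by
  simp [curve]

/-- Entries of the derivative of the curve. [folklore] -/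
lemma dcurve_apply (C : M2) (θ : ℝ) (a b : Fin 2) :
    dcurve C θ a b = (-Real.sin θ : ℂ) * (1 : M2) a b + (Real.cos θ : ℂ) * C a b := by
  simp [dcurve]

/-- The curve passes through `1` at `θ = 0`. [folklore] -/
@[simp] lemma curve_zero (C : M2) : curve C 0 = 1 := by simp [curve]
/-- The velocity of the curve at `θ = 0` is `C`. [folklore] -/
@[simp] lemma dcurve_zero (C : M2) : dcurve C 0 = C := by simp [dcurve]

/-- The curve is continuous. [folklore] -/
lemma continuous_curve (C : M2) : Continuous (curve C) := by
  unfold curve; fun_prop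

/-- The derivative of the curve is continuous. [folklore] -/
lemma continuous_dcurve (C : M2) : Continuous (dcurve C) := by
  unfold dcurve; fun_prop

/-- Entrywise derivative of the curve. [folklore] -/
lemma hasDerivAt_curve (C : M2) (θ : ℝ) (a b : Fin 2) :
    HasDerivAt (fun θ => curve C θ a b) (dcurve C θ a b) θ := by
  simp only [curve_apply, dcurve_apply]
  have h := (((Real.hasDerivAt_cos θ).ofReal_comp).mul_const ((1 : M2) a b)).fun_add
    (((Real.hasDerivAt_sin θ).ofReal_comp).mul_const (C a b))
  simpa using h

/-- Membership of the curve in `SU(2)` for a generator with `C* = -C`, `C² = -1`,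
`tr C = 0`, `det C = 1`. [folklore] -/
lemma curve_mem {C : M2} (hCs : star C = -C) (hC2 : C * C = -1) (htr : C.trace = 0)
    (hdet : C.det = 1) (θ : ℝ) : curve C θ ∈ Matrix.specialUnitaryGroup (Fin 2) ℂ := by
  rw [Matrix.mem_specialUnitaryGroup_iff, Matrix.mem_unitaryGroup_iff]
  have key : (Real.cos θ : ℂ) * Real.cos θ + Real.sin θ * Real.sin θ = 1 := by
    have h := Real.cos_sq_add_sin_sq θ
    exact_mod_cast (by nlinarith [h] : Real.cos θ * Real.cos θ + Real.sin θ * Real.sin θ = 1)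
  refine ⟨?_, ?_⟩
  · have hs : star (curve C θ) = (Real.cos θ : ℂ) • (1 : M2) - (Real.sin θ : ℂ) • C := by
      simp only [curve, star_add, star_smul, star_one, hCs, Complex.star_def,
        Complex.conj_ofReal, smul_neg, sub_eq_add_neg]
    rw [hs, curve]
    simp only [add_mul, mul_sub, smul_mul_smul_comm, Matrix.one_mul, Matrix.mul_one, hC2,
      smul_neg]
    rw [mul_comm (Real.sin θ : ℂ) (Real.cos θ)]
    trans ((Real.cos θ : ℂ) * Real.cos θ) • (1 : M2) + ((Real.sin θ : ℂ) * Real.sin θ) • (1 : M2)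
    · abel
    · rw [← add_smul, key, one_smul]
  · rw [Matrix.det_fin_two]
    simp only [curve_apply]
    rw [Matrix.trace_fin_two] at htr
    rw [Matrix.det_fin_two] at hdet
    simp only [Matrix.one_apply_eq, Matrix.one_apply_ne (by decide : (0 : Fin 2) ≠ 1),
      Matrix.one_apply_ne (by decide : (1 : Fin 2) ≠ 0)]
    linear_combination (Real.sin θ : ℂ) * Real.cos θ * htr +
      (Real.sin θ : ℂ) * Real.sin θ * hdet + key

/-- `C₁* = -C₁`. [folklore] -/
lemma star_C1 : star C1 = -C1 := by
  ext i j; fin_cases i <;> fin_cases j <;> simp [C1, Matrix.star_apply]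
/-- `C₂* = -C₂`. [folklore] -/
lemma star_C2 : star C2 = -C2 := by
  ext i j; fin_cases i <;> fin_cases j <;> simp [C2, Matrix.star_apply]
/-- `C₃* = -C₃`. [folklore] -/
lemma star_C3 : star C3 = -C3 := by
  ext i j; fin_cases i <;> fin_cases j <;> simp [C3, Matrix.star_apply]
/-- `C₁² = -1`. [folklore] -/
lemma C1_mul_C1 : C1 * C1 = -1 := by
  ext i j; fin_cases i <;> fin_cases j <;> simp [C1]
/-- `C₂² = -1`. [folklore] -/
lemma C2_mul_C2 : C2 * C2 = -1 := by
  ext i j; fin_cases i <;> fin_cases j <;> simp [C2]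
/-- `tr C₁ = 0`. [folklore] -/
lemma trace_C1 : C1.trace = 0 := by simp [C1, Matrix.trace_fin_two]
/-- `tr C₂ = 0`. [folklore] -/
lemma trace_C2 : C2.trace = 0 := by simp [C2, Matrix.trace_fin_two]
/-- `tr C₃ = 0`. [folklore] -/
lemma trace_C3 : C3.trace = 0 := by simp [C3, Matrix.trace_fin_two]
/-- `det C₁ = 1`. [folklore] -/
lemma det_C1 : C1.det = 1 := by simp [C1, Matrix.det_fin_two]
/-- `det C₂ = 1`. [folklore] -/
lemma det_C2 : C2.det = 1 := by simp [C2, Matrix.det_fin_two]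
/-- `det C₃ = 1`. [folklore] -/
lemma det_C3 : C3.det = 1 := by simp [C3, Matrix.det_fin_two]

/-- For `0 < |θ| < 2π` the rotation `cos θ + sin θ C₂` is not the identity. [folklore] -/
lemma curve_C2_ne_one {θ : ℝ} (h1 : -(2 * Real.pi) < θ) (h2 : θ < 2 * Real.pi) (h0 : θ ≠ 0) :
    curve C2 θ ≠ 1 := by
  intro h
  have := congrFun (congrFun h 0) 0
  simp [curve_apply, C2] at this
  have : Real.cos θ = 1 := by exact_mod_cast this
  exact h0 ((Real.cos_eq_one_iff_of_lt_of_lt h1 h2).1 this)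

/-- The element of `SU(2)` on the curve. [folklore] -/
def gC2 (θ : ℝ) : SU2 := ⟨curve C2 θ, curve_mem star_C2 C2_mul_C2 trace_C2 det_C2 θ⟩

/-- The identity of `SU(2)` is not isolated (the rotation curve accumulates at `1`); this is the hypothesis of Mathlib's `IsHaarMeasure.nullSingletonClass`. [folklore] -/
theorem nhdsNE_one_neBot : (𝓝[≠] (1 : SU2)).NeBot := by
  have hc : Continuous gC2 := (continuous_curve C2).subtype_mk _
  have h0 : gC2 0 = 1 := Subtype.ext (curve_zero C2)
  have ht : Tendsto gC2 (𝓝[≠] 0) (𝓝[≠] 1) := by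
    refine tendsto_nhdsWithin_iff.2 ⟨?_, ?_⟩
    · rw [← h0]; exact hc.continuousAt.tendsto.mono_left nhdsWithin_le_nhds
    · have : Set.Ioo (-(2 * Real.pi)) (2 * Real.pi) ∈ 𝓝 (0 : ℝ) :=
        Ioo_mem_nhds (by linarith [Real.pi_pos]) (by linarith [Real.pi_pos])
      filter_upwards [self_mem_nhdsWithin, mem_nhdsWithin_of_mem_nhds this] with θ hθ hθ'
      intro h
      exact curve_C2_ne_one hθ'.1 hθ'.2 hθ (congrArg Subtype.val h)
  exact ht.neBot

/-- Haar measure on `SU(2)` charges no point (Mathlib's `IsHaarMeasure.nullSingletonClass`,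
whose hypothesis `(𝓝[≠] 1).NeBot` is `nhdsNE_one_neBot`). [folklore] -/
instance : NullSingletonClass μH := by
  haveI := nhdsNE_one_neBot
  unfold μH haarProbability
  infer_instance

/-! #### The image measure on configurations -/

/-- The law of the random configuration `Ψ U`, `U` Haar distributed. [folklore] -/
def P : Measure AxialConfig := Measure.map Ψ μH

/-- `P` is a probability measure. [folklore] -/
instance : IsProbabilityMeasure P :=
  Measure.isProbabilityMeasure_map measurable_Ψ.aemeasurable

/-- `P`-almost every configuration is a witness configuration `Ψ U` (the range of `Ψ` is sandwiched by the measurable structure set). [folklore] -/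
lemma ae_range_Ψ : ∀ᵐ A ∂P, A ∈ Set.range Ψ := by
  obtain ⟨D, hDc, hDd⟩ := TopologicalSpace.exists_countable_dense E4
  have hsub : (Set.range Ψ)ᶜ ⊆ (Rset D)ᶜ := by
    intro A hA hA'
    obtain ⟨U, rfl⟩ := eq_Ψ_of_mem_Rset hDd hA'
    exact hA ⟨U, rfl⟩
  rw [ae_iff]
  refine measure_mono_null (fun A hA => hsub hA) ?_
  rw [P, Measure.map_apply measurable_Ψ (measurableSet_Rset hDc).compl]
  have : Ψ ⁻¹' (Rset D)ᶜ = ∅ := Set.eq_empty_iff_forall_notMem.2 fun U hU => hU (Ψ_mem_Rset D U)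
  rw [this, measure_empty]

/-- Transfer of an identity along the witness map to a `P`-a.e. identity. [folklore] -/
lemma ae_eq_comp {β : Type*} (f g : AxialConfig → β) (h : ∀ U, f (Ψ U) = g (Ψ U)) :
    f =ᵐ[P] g := by
  filter_upwards [ae_range_Ψ] with A hA
  obtain ⟨U, rfl⟩ := hA
  exact h U

/-! #### Fibres of the witness map and atomlessness -/

/-- A matrix of determinant `1` commuting with `C₃` and `C₂` is `±1`. [folklore] -/
lemma commute_C3_C2 {W : M2} (h3 : C3 * W = W * C3) (h2 : C2 * W = W * C2) (hdet : W.det = 1) :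
    W = 1 ∨ W = -1 := by
  have e01 := congrFun (congrFun h3 0) 1
  have e10 := congrFun (congrFun h3 1) 0
  have e00 := congrFun (congrFun h2 0) 1
  simp [C3, C2, Matrix.mul_apply] at e01 e10 e00
  have h01 : W 0 1 = 0 := by
    have : (2 * Complex.I) * W 0 1 = 0 := by linear_combination e01
    simpa [Complex.I_ne_zero] using this
  have h10 : W 1 0 = 0 := by
    have : (2 * Complex.I) * W 1 0 = 0 := by linear_combination -e10
    simpa [Complex.I_ne_zero] using this
  have h11 : W 1 1 = W 0 0 := by linear_combination e00
  rw [Matrix.det_fin_two, h01, h11] at hdet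
  have hsq : W 0 0 * W 0 0 = 1 := by linear_combination hdet
  rcases mul_self_eq_one_iff.1 hsq with h | h
  · left
    ext i j; fin_cases i <;> fin_cases j <;> simp [h, h01, h10, h11]
  · right
    ext i j; fin_cases i <;> fin_cases j <;> simp [h, h01, h10, h11]

/-- Fibres of the witness map: `Ψ V = Ψ U` forces `V = ±U` (the adjoint action of `SU(2)` has kernel `{±1}`). [folklore] -/
lemma Ψ_fibre {U V : SU2} (h : Ψ V = Ψ U) : V.1 = U.1 ∨ V.1 = -U.1 := by
  have hc : ∀ μ, conjB V μ = conjB U μ := fun μ => by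
    have := congrArg (fun A : AxialConfig => (A : Connection E4 M2) 0 (EuclideanSpace.single μ 1)) h
    simpa [conn_single] using this
  -- W := U⋆ V commutes with C3 and C2
  set W : M2 := star U.1 * V.1 with hW
  have hcomm : ∀ μ, B μ * W = W * B μ := fun μ => by
    have h1 := hc μ
    rw [conjB_apply, conjB_apply] at h1
    have h2 := congrArg (fun M : M2 => star U.1 * M * V.1) h1
    simp only [Matrix.mul_assoc, hW] at h2 ⊢
    rw [star_mul_self V, Matrix.mul_one, ← Matrix.mul_assoc (star U.1) U.1, star_mul_self U,
      Matrix.one_mul] at h2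
    exact h2.symm
  have hUdet : U.1.det = 1 := (Matrix.mem_specialUnitaryGroup_iff.1 U.prop).2
  have hVdet : V.1.det = 1 := (Matrix.mem_specialUnitaryGroup_iff.1 V.prop).2
  have hdet : W.det = 1 := by
    rw [hW, Matrix.det_mul, Matrix.star_eq_conjTranspose, Matrix.det_conjTranspose, hUdet,
      hVdet, star_one, one_mul]
  rcases commute_C3_C2 (by simpa using hcomm 1) (by simpa using hcomm 2) hdet with h1 | h1
  · left
    have : U.1 * W = V.1 := by rw [hW, ← Matrix.mul_assoc, mul_star_self, Matrix.one_mul]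
    rw [← this, h1, Matrix.mul_one]
  · right
    have : U.1 * W = V.1 := by rw [hW, ← Matrix.mul_assoc, mul_star_self, Matrix.one_mul]
    rw [← this, h1, Matrix.mul_neg, Matrix.mul_one]

/-- Fibres of the witness map are Haar-null (at most two points). [folklore] -/
lemma measure_preimage_Ψ_singleton (A : AxialConfig) : μH (Ψ ⁻¹' {A}) = 0 := by
  by_cases hne : (Ψ ⁻¹' {A}).Nonempty
  · obtain ⟨U, hU⟩ := hne
    have hsub : Ψ ⁻¹' {A} ⊆ {V : SU2 | V.1 = U.1} ∪ {V : SU2 | V.1 = -U.1} := by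
      intro V hV
      have : Ψ V = Ψ U := by rw [Set.mem_preimage, Set.mem_singleton_iff] at hU hV; rw [hU, hV]
      exact Ψ_fibre this
    refine measure_mono_null hsub (nonpos_iff_eq_zero.1 ((measure_union_le _ _).trans ?_))
    have h1 : ({V : SU2 | V.1 = U.1} : Set SU2).Subsingleton := fun a ha b hb =>
      Subtype.ext (ha.trans hb.symm)
    have h2 : ({V : SU2 | V.1 = -U.1} : Set SU2).Subsingleton := fun a ha b hb =>
      Subtype.ext (ha.trans hb.symm)
    rw [h1.measure_zero, h2.measure_zero, add_zero]
  · rw [Set.not_nonempty_iff_eq_empty.1 hne, measure_empty]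

/-- Every multiple of `P` charges no single configuration (`AxialConfig` has measurable
singletons; the fibres of `Ψ` are Haar-null). [folklore] -/
instance (c : ℝ≥0∞) : NullSingletonClass (c • P) where
  measure_singleton A := by
    rw [Measure.smul_apply, P, Measure.map_apply measurable_Ψ (measurableSet_singleton A),
      measure_preimage_Ψ_singleton, smul_zero]

/-! #### Volume of the cube -/

/-- Lebesgue measure of the cube `[0, L]⁴` is `L⁴` (`L ≥ 0`). [folklore] -/
lemma volume_mrsCube (L : ℝ) : volume (mrsCube L) = ENNReal.ofReal L ^ 4 := by
  have hmp := PiLp.volume_preserving_ofLp (Fin 4)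
  have : mrsCube L = (WithLp.ofLp : E4 → (Fin 4 → ℝ)) ⁻¹' Set.univ.pi fun _ => Set.Icc 0 L := rfl
  rw [this, hmp.measure_preimage
    (MeasurableSet.univ_pi fun _ => measurableSet_Icc).nullMeasurableSet, volume_pi_pi]
  simp [Real.volume_Icc]

/-- Real Lebesgue measure of the cube `[0, L]⁴` is `L⁴`. [folklore] -/
lemma volume_real_mrsCube {L : ℝ} (hL : 0 ≤ L) : volume.real (mrsCube L) = L ^ 4 := by
  rw [Measure.real, volume_mrsCube L, ENNReal.toReal_pow, ENNReal.toReal_ofReal hL]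

/-! #### Curvature, density and action of constant connections -/

/-- The curvature of a constant connection is the commutator term `[A_u, A_v]` (A14 `curvature`, `fderiv` of a constant vanishes). [folklore] -/
lemma curvature_conn (T : Fin 4 → M2) (x u v : E4) :
    curvature (conn T) x u v = ⁅conn T 0 u, conn T 0 v⁆ := by
  simp [curvature, conn]

/-- The (constant) Yang–Mills density of the constant connection with frame `T`. [folklore] -/
def ρ (T : Fin 4 → M2) : ℝ :=
  ∑ i, ∑ j, if i < j then
    ‖⁅conn T 0 (stdOrthonormalBasis ℝ E4 i), conn T 0 (stdOrthonormalBasis ℝ E4 j)⁆‖ ^ 2 else 0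

/-- The density constant is nonnegative. [folklore] -/
lemma ρ_nonneg (T : Fin 4 → M2) : 0 ≤ ρ T :=
  Finset.sum_nonneg fun _ _ => Finset.sum_nonneg fun _ _ => by split_ifs <;> positivity

/-- The Yang–Mills density (A14 `ymDensity`) of a constant connection is the constant `ρ T`. [folklore] -/
lemma ymDensity_conn (T : Fin 4 → M2) (x : E4) : ymDensity (conn T) x = ρ T := by
  simp only [ymDensity, ymDensityOfBasis, curvature_conn, ρ]

/-- The localised action of a constant connection is `vol(Λ) ρ T`. [folklore] -/
lemma ymActionOn_conn (Λ : Set E4) (T : Fin 4 → M2) :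
    ymActionOn Λ (conn T) = volume.real Λ * ρ T := by
  simp only [ymActionOn, ymDensity_conn]
  rw [setIntegral_const, smul_eq_mul]

/-- Commutators are equivariant under unitary conjugation. [folklore] -/
lemma lie_conj {g : M2} (hg : star g * g = 1) (X Y : M2) :
    ⁅g * X * star g, g * Y * star g⁆ = g * ⁅X, Y⁆ * star g := by
  have hcan : ∀ W : M2, star g * (g * W) = W := fun W => by
    rw [← Matrix.mul_assoc, hg, Matrix.one_mul]
  simp only [Ring.lie_def, mul_sub, sub_mul, Matrix.mul_assoc, hcan]

/-- The Frobenius norm is invariant under unitary conjugation (prelude `Matrix.frobenius_norm_unitaryGroup_mul`). [folklore] -/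
lemma norm_conj {g : M2} (hg : g ∈ Matrix.unitaryGroup (Fin 2) ℂ) (M : M2) :
    ‖g * M * star g‖ = ‖M‖ := by
  have h1 := Matrix.frobenius_norm_mul_unitaryGroup (g * M)
    (star (⟨g, hg⟩ : Matrix.unitaryGroup (Fin 2) ℂ))
  have h2 := Matrix.frobenius_norm_unitaryGroup_mul (⟨g, hg⟩ : Matrix.unitaryGroup (Fin 2) ℂ) M
  exact h1.trans h2

/-- The density constant is invariant under unitary conjugation of the frame. [folklore] -/
lemma ρ_conjT {g : M2} (hg : g ∈ Matrix.unitaryGroup (Fin 2) ℂ) (T : Fin 4 → M2) :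
    ρ (conjT g T) = ρ T := by
  simp only [ρ, conn_conjT, lie_conj hg.1, norm_conj hg]

/-- All witness configurations have the same density constant `ρ B`. [folklore] -/
lemma ρ_conjB (U : SU2) : ρ (conjB U) = ρ B := ρ_conjT U.prop.1 B

/-- The density constant of the frame `B` is positive: the antisymmetric bilinear map `(u, v) ↦ [B(u), B(v)]` is non-zero (`[C₃, C₂] ≠ 0`), hence cannot vanish on all pairs of vectors of the orthonormal frame `stdOrthonormalBasis`. [folklore] -/
lemma ρ_B_pos : 0 < ρ B := by
  set b := stdOrthonormalBasis ℝ E4 with hb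
  by_contra h
  have h0 : ρ B = 0 := le_antisymm (not_lt.1 h) (ρ_nonneg B)
  have hterm : ∀ i j, i < j → ⁅conn B 0 (b i), conn B 0 (b j)⁆ = 0 := by
    intro i j hij
    have h1 := (Finset.sum_eq_zero_iff_of_nonneg (fun i _ => Finset.sum_nonneg fun j _ => by
      split_ifs <;> positivity)).1 h0 i (Finset.mem_univ _)
    have h2 := (Finset.sum_eq_zero_iff_of_nonneg (fun j _ => by
      split_ifs <;> positivity)).1 h1 j (Finset.mem_univ _)
    rw [if_pos hij] at h2
    exact norm_eq_zero.1 ((pow_eq_zero_iff two_ne_zero).1 h2)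
  have hcomm : ∀ i j, conn B 0 (b i) * conn B 0 (b j) = conn B 0 (b j) * conn B 0 (b i) := by
    intro i j
    rcases lt_trichotomy i j with hij | rfl | hji
    · exact sub_eq_zero.1 (by simpa only [Ring.lie_def] using hterm i j hij)
    · rfl
    · exact (sub_eq_zero.1 (by simpa only [Ring.lie_def] using hterm j i hji)).symm
  have key : conn B 0 (EuclideanSpace.single 1 1) * conn B 0 (EuclideanSpace.single 2 1) -
      conn B 0 (EuclideanSpace.single 2 1) * conn B 0 (EuclideanSpace.single 1 1) = 0 := by
    rw [← b.sum_repr (EuclideanSpace.single 1 1), ← b.sum_repr (EuclideanSpace.single 2 1)]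
    simp only [map_sum, map_smul, Finset.sum_mul_sum, smul_mul_smul_comm, sub_eq_zero]
    rw [Finset.sum_comm]
    exact Finset.sum_congr rfl fun i _ => Finset.sum_congr rfl fun j _ => by
      rw [hcomm j i, mul_comm]
  rw [conn_single, conn_single, B_one, B_two] at key
  exact C3_mul_C2_sub_ne key

/-- The action of the witness configurations in the cube. [folklore] -/
def sΛ (L : ℝ) : ℝ := volume.real (mrsCube L) * ρ B

/-- The action of the witness configurations in the cube is positive for `L > 0`. [folklore] -/
lemma sΛ_pos {L : ℝ} (hL : 0 < L) : 0 < sΛ L := by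
  rw [sΛ, volume_real_mrsCube hL.le]
  exact mul_pos (pow_pos hL 4) ρ_B_pos

/-- The localised Yang–Mills action of every witness configuration equals `sΛ L`. [folklore] -/
lemma ymActionOn_Ψ (L : ℝ) (U : SU2) :
    ymActionOn (mrsCube L) (conn (conjB U)) = sΛ L := by
  rw [ymActionOn_conn, ρ_conjB, sΛ]

/-! #### Moments and the Schwinger functions of the witness -/

/-- The monomial `∏ⱼ (T_{μⱼ})_{pⱼ qⱼ}` in the frame entries. [folklore] -/
def zmon {m : ℕ} (ι : Fin m → GaugeFieldIndex) (T : Fin 4 → M2) : ℂ :=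
  ∏ j, T (ι j).1 (ι j).2.1 (ι j).2.2

/-- The moment integrand is continuous on `SU(2)`. [folklore] -/
lemma continuous_zmon_conjB {m : ℕ} (ι : Fin m → GaugeFieldIndex) :
    Continuous fun U => zmon ι (conjB U) :=
  continuous_finsetProd _ fun _ _ =>
    ((continuous_apply _).comp continuous_conjB).matrix_elem _ _

/-- The Haar moments `∫ ∏ⱼ (U B_{μⱼ} U⁻¹)_{pⱼ qⱼ} dU`. [folklore] -/
def mom {m : ℕ} (ι : Fin m → GaugeFieldIndex) : ℂ := ∫ U, zmon ι (conjB U) ∂μH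

/-- The Schwinger functions of the witness: `𝔖ₙ^ι(F) = mom ι · ∫ F`. [folklore] -/
def Sw : YMSchwingerFamily := fun n ι =>
  haveI : (volume : Measure (Fin n → E4)).HasTemperateGrowth :=
    Measure.IsAddHaarMeasure.instHasTemperateGrowth
  (mom ι) • SchwartzMap.integralCLM ℂ (volume : Measure (Fin n → E4))

/-- `Sw n ι F = mom ι · ∫ F`. [folklore] -/
lemma Sw_apply (n : ℕ) (ι : Fin n → GaugeFieldIndex) (F : 𝓢((Fin n → E4), ℂ)) :
    Sw n ι F = mom ι * ∫ x, F x := by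
  simp [Sw]

/-- The smeared field monomial of a constant connection factorises as `(∫ F) · ∏ⱼ (T_{μⱼ})_{pⱼqⱼ}`. [folklore] -/
lemma fieldMonomial_conn (n : ℕ) (ι : Fin n → GaugeFieldIndex) (F : 𝓢((Fin n → E4), ℂ))
    (T : Fin 4 → M2) : fieldMonomial n ι F (conn T) = (∫ x, F x) * zmon ι T := by
  simp only [fieldMonomial, gaugeFieldComponent, conn_single, zmon]
  exact integral_mul_const _ _

/-- The frame monomial is a measurable function of the configuration. [folklore] -/
lemma measurable_zmon_Zf {m : ℕ} (ι : Fin m → GaugeFieldIndex) :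
    Measurable fun A : AxialConfig => zmon ι (Zf A) :=
  Finset.measurable_prod _ fun _ _ => measurable_eval_entry 0 _ _ _

/-- The Schwinger functions of `P`: `∫ fieldMonomial dP = mom ι · ∫ F`. [folklore] -/
lemma integral_fieldMonomial_P (n : ℕ) (ι : Fin n → GaugeFieldIndex) (F : 𝓢((Fin n → E4), ℂ)) :
    ∫ A, fieldMonomial n ι F (A : Connection E4 M2) ∂P = mom ι * ∫ x, F x := by
  have hae := ae_eq_comp (fun A => fieldMonomial n ι F (A : Connection E4 M2))
    (fun A => (∫ x, F x) * zmon ι (Zf A)) fun U => by rw [coe_Ψ, fieldMonomial_conn, Zf_Ψ]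
  rw [integral_congr_ae hae, P, integral_map measurable_Ψ.aemeasurable
    ((measurable_zmon_Zf ι).const_mul (∫ x, F x)).aestronglyMeasurable]
  simp only [Zf_Ψ]
  rw [integral_const_mul, mom, mul_comm]

/-- Field monomials are `P`-integrable. [folklore] -/
lemma integrable_fieldMonomial_P (n : ℕ) (ι : Fin n → GaugeFieldIndex)
    (F : 𝓢((Fin n → E4), ℂ)) :
    Integrable (fun A : AxialConfig => fieldMonomial n ι F (A : Connection E4 M2)) P := by
  have hae := ae_eq_comp (fun A => fieldMonomial n ι F (A : Connection E4 M2))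
    (fun A => (∫ x, F x) * zmon ι (Zf A)) fun U => by rw [coe_Ψ, fieldMonomial_conn, Zf_Ψ]
  refine Integrable.congr ?_ hae.symm
  refine (integrable_map_measure ((measurable_zmon_Zf ι).const_mul (∫ x, F x)).aestronglyMeasurable
    measurable_Ψ.aemeasurable).2 ?_
  have : (fun A => (∫ x, F x) * zmon ι (Zf A)) ∘ Ψ = fun U => (∫ x, F x) * zmon ι (conjB U) := by
    funext U; simp
  rw [P] at *
  rw [this]
  exact integrable_of_continuous (continuous_const.mul (continuous_zmon_conjB ι))

/-! #### Non-degeneracy: `Sw 2 ≠ 0` -/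

/-- A bump test function with non-zero integral. [folklore] -/
def bump2 : ContDiffBump (0 : Fin 2 → E4) := ⟨1, 2, one_pos, one_lt_two⟩

/-- The same as a complex-valued Schwartz function. [folklore] -/
def Fbump : 𝓢((Fin 2 → E4), ℂ) :=
  HasCompactSupport.toSchwartzMap (f := fun x => ((bump2 x : ℝ) : ℂ))
    (bump2.hasCompactSupport.comp_left Complex.ofReal_zero)
    (Complex.ofRealCLM.contDiff.comp bump2.contDiff)

/-- The bump test function has non-zero integral. [folklore] -/
lemma integral_Fbump_ne : (∫ x, Fbump x) ≠ 0 := by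
  show (∫ x, ((bump2 x : ℝ) : ℂ)) ≠ 0
  rw [integral_complex_ofReal]
  exact_mod_cast (bump2.integral_pos (μ := volume)).ne'

/-- The index pairs `((1,p,q),(1,q,p))`. [folklore] -/
def ι2 (p q : Fin 2) : Fin 2 → GaugeFieldIndex := ![(1, p, q), (1, q, p)]

/-- The degree-two monomial for the index pair `ι2 p q`. [folklore] -/
lemma zmon_ι2 (p q : Fin 2) (T : Fin 4 → M2) : zmon (ι2 p q) T = T 1 p q * T 1 q p := by
  simp [zmon, ι2, Fin.prod_univ_two]

/-- `∑_{pq} (U C₃ U⁻¹)_{pq} (U C₃ U⁻¹)_{qp} = tr C₃² = -2` for every `U`. [folklore] -/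
lemma sum_zmon_ι2 (U : SU2) : ∑ p, ∑ q, zmon (ι2 p q) (conjB U) = -2 := by
  simp only [zmon_ι2]
  have h1 : ∑ p, ∑ q, conjB U 1 p q * conjB U 1 q p = ((conjB U 1) * (conjB U 1)).trace := by
    simp only [Matrix.trace, Matrix.diag, Matrix.mul_apply, Fin.sum_univ_two]
  rw [h1, conjB_apply, B_one]
  have h2 : U.1 * C3 * star U.1 * (U.1 * C3 * star U.1) = U.1 * (C3 * C3) * star U.1 := by
    simp only [Matrix.mul_assoc]
    rw [← Matrix.mul_assoc (star U.1) U.1, star_mul_self, Matrix.one_mul]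
  rw [h2, Matrix.trace_mul_cycle, ← Matrix.mul_assoc, star_mul_self, Matrix.one_mul,
    trace_C3_mul_C3]

/-- The degree-two moments sum to `-2`. [folklore] -/
lemma sum_mom_ι2 : ∑ p, ∑ q, mom (ι2 p q) = -2 := by
  simp only [mom]
  have hint : ∀ p q, Integrable (fun U => zmon (ι2 p q) (conjB U)) μH := fun p q =>
    integrable_of_continuous (continuous_zmon_conjB _)
  have h1 : ∀ p, ∑ q, ∫ U, zmon (ι2 p q) (conjB U) ∂μH = ∫ U, ∑ q, zmon (ι2 p q) (conjB U) ∂μH :=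
    fun p => (integral_finsetSum _ fun q _ => hint p q).symm
  simp only [h1]
  rw [← integral_finsetSum _ fun p _ => integrable_finsetSum _ fun q _ => hint p q]
  simp only [sum_zmon_ι2]
  simp

/-- Non-degeneracy: the two-point function of the witness does not vanish identically. [folklore] -/
lemma Sw_two_ne_zero : Sw 2 ≠ 0 := by
  intro h
  have h0 : ∀ p q, mom (ι2 p q) = 0 := fun p q => by
    have := congrArg (fun S : (Fin 2 → GaugeFieldIndex) → (𝓢((Fin 2 → E4), ℂ) →L[ℂ] ℂ) =>
      S (ι2 p q) Fbump) h
    rw [Sw_apply, Pi.zero_apply] at this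
    exact (mul_eq_zero.1 this).resolve_right integral_Fbump_ne
  have := sum_mom_ι2
  simp [h0] at this

/-! #### Infinitesimal conjugation invariance of the Haar moments -/

section Ward

variable {m : ℕ} (ι : Fin m → GaugeFieldIndex) (C : M2)

/-- The moment integrand transported along the curve `θ ↦ cos θ + sin θ C`. [folklore] -/
def Fθ (θ : ℝ) (U : SU2) : ℂ :=
  ∏ j, (curve C θ * conjB U (ι j).1 * star (curve C θ)) (ι j).2.1 (ι j).2.2

/-- Its `θ`-derivative. [folklore] -/
def Fθ' (θ : ℝ) (U : SU2) : ℂ :=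
  ∑ i, (∏ j ∈ univ.erase i, (curve C θ * conjB U (ι j).1 * star (curve C θ)) (ι j).2.1 (ι j).2.2) *
    ((dcurve C θ * conjB U (ι i).1 * star (curve C θ) +
      curve C θ * conjB U (ι i).1 * star (dcurve C θ)) (ι i).2.1 (ι i).2.2)

omit ι C in
/-- Leibniz rule for the entries of `θ ↦ v(θ) M v(θ)*`. [folklore] -/
lemma hasDerivAt_conj_entry {v dv : ℝ → M2}
    (hv : ∀ θ a b, HasDerivAt (fun θ => v θ a b) (dv θ a b) θ) (M : M2) (p q : Fin 2) (θ : ℝ) :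
    HasDerivAt (fun θ => (v θ * M * star (v θ)) p q)
      ((dv θ * M * star (v θ) + v θ * M * star (dv θ)) p q) θ := by
  simp only [Matrix.mul_apply, Matrix.star_apply, Matrix.add_apply]
  refine (HasDerivAt.fun_sum fun b _ =>
    ((HasDerivAt.fun_sum fun a _ => (hv θ p a).mul_const (M a b)).fun_mul
      (hv θ q b).star)).congr_deriv ?_
  rw [Finset.sum_add_distrib]

/-- The transported moment integrand is differentiable in `θ` with derivative `Fθ'`. [folklore] -/
lemma hasDerivAt_Fθ (θ : ℝ) (U : SU2) :
    HasDerivAt (fun θ => Fθ ι C θ U) (Fθ' ι C θ U) θ := by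
  unfold Fθ Fθ'
  have := HasDerivAt.fun_finsetProd (u := univ) (x := θ) fun j _ =>
    hasDerivAt_conj_entry (hasDerivAt_curve C) (conjB U (ι j).1) (ι j).2.1 (ι j).2.2 θ
  simpa only [smul_eq_mul] using this

/-- The transported moment integrand is continuous on `SU(2)`. [folklore] -/
lemma continuous_Fθ (θ : ℝ) : Continuous (Fθ ι C θ) :=
  continuous_finsetProd _ fun _ _ =>
    ((continuous_const.mul ((continuous_apply _).comp continuous_conjB)).mul
      continuous_const).matrix_elem _ _

/-- The derivative of the transported integrand is jointly continuous in `(θ, U)` (used for the domination bound on `[-1, 1] × SU(2)`). [folklore] -/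
lemma continuous_Fθ'_uncurry : Continuous fun p : ℝ × SU2 => Fθ' ι C p.1 p.2 := by
  unfold Fθ'
  have hc : Continuous fun p : ℝ × SU2 => curve C p.1 := (continuous_curve C).comp continuous_fst
  have hd : Continuous fun p : ℝ × SU2 => dcurve C p.1 := (continuous_dcurve C).comp continuous_fst
  have hB : ∀ μ, Continuous fun p : ℝ × SU2 => conjB p.2 μ := fun μ =>
    (continuous_apply μ).comp (continuous_conjB.comp continuous_snd)
  refine continuous_finsetSum _ fun i _ => (continuous_finsetProd _ fun _ _ => ?_).mul ?_
  · exact ((hc.mul (hB _)).mul hc.star).matrix_elem _ _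
  · exact (((hd.mul (hB _)).mul hc.star).add ((hc.mul (hB _)).mul hd.star)).matrix_elem _ _

/-- The transported integrand is the moment integrand composed with left translation by the curve. [folklore] -/
lemma Fθ_eq (hmem : ∀ θ, curve C θ ∈ Matrix.specialUnitaryGroup (Fin 2) ℂ) (θ : ℝ) (U : SU2) :
    Fθ ι C θ U = zmon ι (conjB ((⟨curve C θ, hmem θ⟩ : SU2) * U)) := by
  simp [Fθ, zmon, conjB_mul]

/-- At `θ = 0` the derivative of the transported integrand is the `ad C`-derivative of the moment integrand. [folklore] -/
lemma Fθ'_zero (hCs : star C = -C) (U : SU2) :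
    Fθ' ι C 0 U = ∑ i, (∏ j ∈ univ.erase i, conjB U (ι j).1 (ι j).2.1 (ι j).2.2) *
      ((C * conjB U (ι i).1 - conjB U (ι i).1 * C) (ι i).2.1 (ι i).2.2) := by
  simp [Fθ', hCs, sub_eq_add_neg]

/-- **Infinitesimal invariance.** For a generator `C` whose curve stays in `SU(2)`, the Haar
integral of the `ad C`-derivative of the moment integrand vanishes (left invariance of Haar
measure plus differentiation under the integral sign). [folklore] -/
theorem integral_ward_eq_zero (hmem : ∀ θ, curve C θ ∈ Matrix.specialUnitaryGroup (Fin 2) ℂ)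
    (hCs : star C = -C) :
    ∫ U, (∑ i, (∏ j ∈ univ.erase i, conjB U (ι j).1 (ι j).2.1 (ι j).2.2) *
      ((C * conjB U (ι i).1 - conjB U (ι i).1 * C) (ι i).2.1 (ι i).2.2)) ∂μH = 0 := by
  have hconst : ∀ θ, ∫ U, Fθ ι C θ U ∂μH = ∫ U, zmon ι (conjB U) ∂μH := by
    intro θ
    simp only [Fθ_eq ι C hmem]
    exact integral_mul_left_eq_self (fun U => zmon ι (conjB U)) _
  have hD0 : HasDerivAt (fun θ => ∫ U, Fθ ι C θ U ∂μH) 0 0 := by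
    rw [show (fun θ => ∫ U, Fθ ι C θ U ∂μH) = fun _ => ∫ U, zmon ι (conjB U) ∂μH from
      funext hconst]
    exact hasDerivAt_const _ _
  obtain ⟨K, hK⟩ := ((isCompact_closedBall (0 : ℝ) 1).prod isCompact_univ).exists_bound_of_continuousOn
    (continuous_Fθ'_uncurry ι C).continuousOn
  have hD := (hasDerivAt_integral_of_dominated_loc_of_deriv_le (μ := μH) (F := Fθ ι C)
    (F' := Fθ' ι C) (x₀ := (0 : ℝ)) (bound := fun _ => K) (s := Metric.ball 0 1)
    (Metric.ball_mem_nhds 0 one_pos)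
    (Eventually.of_forall fun θ => (continuous_Fθ ι C θ).aestronglyMeasurable)
    (integrable_of_continuous (continuous_Fθ ι C 0))
    ((continuous_Fθ'_uncurry ι C).comp (Continuous.prodMk_right 0)).aestronglyMeasurable
    (ae_of_all _ fun U θ hθ => hK (θ, U) ⟨Metric.ball_subset_closedBall hθ, Set.mem_univ _⟩)
    (integrable_const K)
    (ae_of_all _ fun U θ _ => hasDerivAt_Fθ ι C θ U)).2
  have h0 : ∫ U, Fθ' ι C 0 U ∂μH = 0 := hD.unique hD0
  simpa only [Fθ'_zero ι C hCs] using h0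

end Ward

/-! #### The Ward sum and its vanishing on `𝔰𝔲(2)` -/

section WardSum

variable {n : ℕ} (ι : Fin (n + 1) → GaugeFieldIndex)

/-- The combination of moments appearing in the global Slavnov identity. [folklore] -/
def Wsum (C : M2) : ℂ :=
  ∑ i, (∑ r, mom (Function.update ι i ((ι i).1, (ι i).2.1, r)) * C r (ι i).2.2 -
    ∑ r, mom (Function.update ι i ((ι i).1, r, (ι i).2.2)) * C (ι i).2.1 r)

omit ι in
/-- Updating one index of the monomial factors off the corresponding entry. [folklore] -/
lemma zmon_update {m : ℕ} (ι : Fin m → GaugeFieldIndex) (i : Fin m) (v : GaugeFieldIndex)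
    (T : Fin 4 → M2) :
    zmon (Function.update ι i v) T =
      T v.1 v.2.1 v.2.2 * ∏ j ∈ univ.erase i, T (ι j).1 (ι j).2.1 (ι j).2.2 := by
  rw [zmon, ← Finset.mul_prod_erase _ _ (Finset.mem_univ i), Function.update_self]
  congr 1
  exact Finset.prod_congr rfl fun j hj => by rw [Function.update_of_ne (Finset.ne_of_mem_erase hj)]

/-- Pointwise form of the Ward sum: it is minus the `ad C`-derivative of the moment integrand. [folklore] -/
lemma ward_pointwise (C : M2) (T : Fin 4 → M2) :
    ∑ i, (∑ r, zmon (Function.update ι i ((ι i).1, (ι i).2.1, r)) T * C r (ι i).2.2 -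
         ∑ r, zmon (Function.update ι i ((ι i).1, r, (ι i).2.2)) T * C (ι i).2.1 r) =
    -∑ i, (∏ j ∈ univ.erase i, T (ι j).1 (ι j).2.1 (ι j).2.2) *
      ((C * T (ι i).1 - T (ι i).1 * C) (ι i).2.1 (ι i).2.2) := by
  rw [← Finset.sum_neg_distrib]
  refine Finset.sum_congr rfl fun i _ => ?_
  simp only [zmon_update, Matrix.sub_apply, Matrix.mul_apply]
  set E := ∏ j ∈ univ.erase i, T (ι j).1 (ι j).2.1 (ι j).2.2
  have e1 : ∑ r, T (ι i).1 (ι i).2.1 r * E * C r (ι i).2.2 =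
      E * ∑ r, T (ι i).1 (ι i).2.1 r * C r (ι i).2.2 := by
    rw [Finset.mul_sum]; exact Finset.sum_congr rfl fun r _ => by ring
  have e2 : ∑ r, T (ι i).1 r (ι i).2.2 * E * C (ι i).2.1 r =
      E * ∑ r, C (ι i).2.1 r * T (ι i).1 r (ι i).2.2 := by
    rw [Finset.mul_sum]; exact Finset.sum_congr rfl fun r _ => by ring
  rw [e1, e2]
  ring

/-- The Ward sum is the Haar integral of its pointwise form. [folklore] -/
lemma integral_wardSum (C : M2) :
    ∫ U, (∑ i, (∑ r, zmon (Function.update ι i ((ι i).1, (ι i).2.1, r)) (conjB U) * C r (ι i).2.2 -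
      ∑ r, zmon (Function.update ι i ((ι i).1, r, (ι i).2.2)) (conjB U) * C (ι i).2.1 r)) ∂μH =
    Wsum ι C := by
  have hint : ∀ ι' : Fin (n + 1) → GaugeFieldIndex, ∀ c : ℂ,
      Integrable (fun U => zmon ι' (conjB U) * c) μH := fun ι' c =>
    (integrable_of_continuous (continuous_zmon_conjB ι')).mul_const c
  have h1 : ∀ i, Integrable (fun U => ∑ r, zmon (Function.update ι i ((ι i).1, (ι i).2.1, r))
      (conjB U) * C r (ι i).2.2) μH := fun i => integrable_finsetSum _ fun r _ => hint _ _
  have h2 : ∀ i, Integrable (fun U => ∑ r, zmon (Function.update ι i ((ι i).1, r, (ι i).2.2))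
      (conjB U) * C (ι i).2.1 r) μH := fun i => integrable_finsetSum _ fun r _ => hint _ _
  rw [integral_finsetSum _ fun i _ => (h1 i).sub' (h2 i), Wsum]
  refine Finset.sum_congr rfl fun i _ => ?_
  rw [integral_sub (h1 i) (h2 i), integral_finsetSum _ fun r _ => hint _ _,
    integral_finsetSum _ fun r _ => hint _ _]
  simp only [integral_mul_const, mom]

/-- The Ward sum as (minus) the integral of the `ad C`-derivative of the moment integrand. [folklore] -/
lemma Wsum_eq_integral (C : M2) :
    Wsum ι C = -∫ U, (∑ i, (∏ j ∈ univ.erase i, conjB U (ι j).1 (ι j).2.1 (ι j).2.2) *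
      ((C * conjB U (ι i).1 - conjB U (ι i).1 * C) (ι i).2.1 (ι i).2.2)) ∂μH := by
  rw [← integral_wardSum, ← integral_neg]
  refine integral_congr_ae (ae_of_all _ fun U => ?_)
  dsimp only
  rw [ward_pointwise ι C (conjB U)]

/-- The Ward sum vanishes for a generator whose curve stays in `SU(2)`. [folklore] -/
lemma Wsum_eq_zero_of_curve {C : M2} (hmem : ∀ θ, curve C θ ∈ Matrix.specialUnitaryGroup (Fin 2) ℂ)
    (hCs : star C = -C) : Wsum ι C = 0 := by
  rw [Wsum_eq_integral, integral_ward_eq_zero ι C hmem hCs, neg_zero]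

/-- The Ward sum is additive in the gauge parameter. [folklore] -/
lemma Wsum_add (C C' : M2) : Wsum ι (C + C') = Wsum ι C + Wsum ι C' := by
  rw [Wsum, Wsum, Wsum, ← Finset.sum_add_distrib]
  refine Finset.sum_congr rfl fun i _ => ?_
  simp only [Matrix.add_apply, mul_add, Finset.sum_add_distrib]
  ring

/-- The Ward sum is real-homogeneous in the gauge parameter. [folklore] -/
lemma Wsum_smul (t : ℝ) (C : M2) : Wsum ι (t • C) = t * Wsum ι C := by
  rw [Wsum, Wsum, Finset.mul_sum]
  refine Finset.sum_congr rfl fun i _ => ?_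
  simp only [Matrix.smul_apply, Complex.real_smul, mul_sub, Finset.mul_sum]
  congr 1 <;> exact Finset.sum_congr rfl fun r _ => by ring

/-- The Ward sum vanishes at `C₁`. [folklore] -/
lemma Wsum_C1 : Wsum ι C1 = 0 :=
  Wsum_eq_zero_of_curve ι (curve_mem star_C1 C1_mul_C1 trace_C1 det_C1) star_C1
/-- The Ward sum vanishes at `C₂`. [folklore] -/
lemma Wsum_C2 : Wsum ι C2 = 0 :=
  Wsum_eq_zero_of_curve ι (curve_mem star_C2 C2_mul_C2 trace_C2 det_C2) star_C2
/-- The Ward sum vanishes at `C₃`. [folklore] -/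
lemma Wsum_C3 : Wsum ι C3 = 0 :=
  Wsum_eq_zero_of_curve ι (curve_mem star_C3 C3_mul_C3 trace_C3 det_C3) star_C3

omit ι in
/-- Every element of `𝔰𝔲(2)` is a real combination of `C1, C2, C3`. [folklore] -/
lemma su2_decomp {C : M2} (hC : C ∈ suAlgebra 2) :
    C = (C 0 1).im • C1 + (C 0 1).re • C2 + (C 0 0).im • C3 := by
  rw [mem_suAlgebra_iff] at hC
  obtain ⟨h1, h2⟩ := hC
  have e00 := congrFun (congrFun h1 0) 0
  have e11 := congrFun (congrFun h1 1) 1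
  have e10 := congrFun (congrFun h1 1) 0
  simp only [Matrix.conjTranspose_apply, Matrix.neg_apply] at e00 e11 e10
  rw [Matrix.trace_fin_two] at h2
  have r00 : (C 0 0).re = 0 := by
    have := congrArg Complex.re e00; simp at this; linarith
  have r11 : (C 1 1).re = 0 := by
    have := congrArg Complex.re e11; simp at this; linarith
  have i11 : (C 1 1).im = -(C 0 0).im := by
    have := congrArg Complex.im h2; simp at this; linarith
  have r10 : (C 1 0).re = -(C 0 1).re := by
    have := congrArg Complex.re e10; simp at this; linarith
  have i10 : (C 1 0).im = (C 0 1).im := by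
    have := congrArg Complex.im e10; simp at this; linarith
  ext i j
  fin_cases i <;> fin_cases j <;> simp [C1, C2, C3] <;> apply Complex.ext <;> simp <;> linarith

/-- The Ward sum vanishes on `𝔰𝔲(2)`. [folklore] -/
lemma Wsum_eq_zero {C : M2} (hC : C ∈ suAlgebra 2) : Wsum ι C = 0 := by
  rw [su2_decomp hC, Wsum_add, Wsum_add, Wsum_smul, Wsum_smul, Wsum_smul, Wsum_C1, Wsum_C2,
    Wsum_C3]
  simp

end WardSum

/-! #### The global Slavnov identities for `Sw` -/

/-- The witness family satisfies the global `SU(2)` Slavnov (Ward) identities `SatisfiesSlavnovIdentities`: for constant `ω = C ∈ 𝔰𝔲(2)` the `∂ω`-terms vanish and the remaining combination is `(∫ F) · Wsum ι C = 0`. [folklore] -/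
theorem satisfiesSlavnovIdentities_Sw : SatisfiesSlavnovIdentities Sw := by
  rintro ω ⟨C, hC, rfl⟩ n ι F G Fr Fl hG hFr hFl
  have hG0 : ∀ i, (∫ y, G i y) = 0 := fun i => by
    have : ∀ y, G i y = 0 := fun y => by rw [hG i y]; simp
    simp [this]
  have hFr' : ∀ i r, (∫ x, Fr i r x) = (∫ x, F x) * C r (ι i).2.2 := fun i r => by
    have : ⇑(Fr i r) = fun x => F x * C r (ι i).2.2 := funext (hFr i r); rw [this, integral_mul_const]
  have hFl' : ∀ i r, (∫ x, Fl i r x) = (∫ x, F x) * C (ι i).2.1 r := fun i r => by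
    have : ⇑(Fl i r) = fun x => F x * C (ι i).2.1 r := funext (hFl i r); rw [this, integral_mul_const]
  have key : ∀ i, slavnovVariation Sw ι i (G i) (Fr i) (Fl i) =
      (∫ x, F x) * (∑ r, mom (Function.update ι i ((ι i).1, (ι i).2.1, r)) * C r (ι i).2.2 -
        ∑ r, mom (Function.update ι i ((ι i).1, r, (ι i).2.2)) * C (ι i).2.1 r) := by
    intro i
    simp only [slavnovVariation, Sw_apply, hG0, hFr', hFl', mul_zero, zero_add, Finset.mul_sum,
      mul_sub]
    congr 1 <;> exact Finset.sum_congr rfl fun r _ => by ring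
  rw [Finset.sum_congr rfl fun i _ => key i, ← Finset.mul_sum]
  change (∫ x, F x) * Wsum ι C = 0
  rw [Wsum_eq_zero ι hC, mul_zero]

/-! #### The regularisation data and the limit -/

section Assembly

variable (L g : ℝ)

/-- The reference measures: `(κ + 1) · P`. [folklore] -/
abbrev refM (κ : ℕ) : Measure AxialConfig := ((κ : ℝ≥0∞) + 1) • P

/-- The Gibbs tilt function of the structure (zero counterterms). [folklore] -/
def tiltF (A : AxialConfig) : ℝ :=
  -((g ^ 2)⁻¹ * ymActionOn (mrsCube L) (A : Connection E4 M2) +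
    localCounterterm (mrsCube L) 0 0 (A : Connection E4 M2))

/-- The Gibbs tilt function is `ref κ`-a.e. constant. [folklore] -/
lemma tiltF_ae_const (κ : ℕ) : tiltF L g =ᵐ[refM κ] fun _ => -((g ^ 2)⁻¹ * sΛ L) :=
  Measure.ae_smul_measure (ae_eq_comp _ _ fun U => by simp [tiltF, ymActionOn_Ψ]) _

/-- The Gibbs measures of the data all equal `P` (tilting by an a.e. constant normalises `(κ+1) P`). [folklore] -/
lemma tilted_refM (κ : ℕ) : (refM κ).tilted (tiltF L g) = P := by
  rw [tilted_congr (tiltF_ae_const L g κ), tilted_const', Measure.smul_apply, measure_univ,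
    smul_eq_mul, mul_one, smul_smul, ENNReal.inv_mul_cancel (by simp) (by simp), one_smul]

/-- The expected localised action under `ref κ` is `(κ + 1) sΛ L`. [folklore] -/
lemma integral_action_refM (κ : ℕ) :
    ∫ A, ymActionOn (mrsCube L) (A : Connection E4 M2) ∂(refM κ) = ((κ : ℝ) + 1) * sΛ L := by
  rw [integral_smul_measure, integral_congr_ae (ae_eq_comp _ (fun _ => sΛ L) fun U =>
    ymActionOn_Ψ L U), integral_const, smul_eq_mul, smul_eq_mul]
  simp [ENNReal.toReal_add]

/-- The expected action under the reference measures diverges as `κ → ∞`. [folklore] -/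
lemma tendsto_action (hL : 0 < L) :
    Tendsto (fun κ : ℕ => ∫ A, ymActionOn (mrsCube L) (A : Connection E4 M2) ∂(refM κ))
      atTop atTop := by
  simp only [integral_action_refM]
  exact (tendsto_atTop_add_const_right _ 1 tendsto_natCast_atTop_atTop).atTop_mul_const (sΛ_pos hL)

variable {L} in
/-- The regularised axial-gauge data of the witness. [folklore] -/
def regData (hL : 0 < L) : AxialGaugeYMRegularisation (mrsCube L) g where
  ref := refM
  massCT := fun _ => 0
  fieldCT := fun _ => 0
  fieldCT_nonneg := fun _ => le_rfl
  nullSingleton_ref := fun _ => inferInstance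
  tendsto_action := tendsto_action L hL
  isProbabilityMeasure_tilted := fun κ => by
    change IsProbabilityMeasure ((refM κ).tilted (tiltF L g))
    rw [tilted_refM]; infer_instance

variable {L} in
/-- The regularised laws of the data are all equal to `P`. [folklore] -/
lemma law_regData (hL : 0 < L) (κ : ℕ) : (regData g hL).law κ = P := by
  change (refM κ).tilted (tiltF L g) = P
  exact tilted_refM L g κ

variable {L} in
/-- `Sw` is the UV limit of the (constant) sequence of regularised Schwinger functions. [folklore] -/
lemma hasUVLimit_regData (hL : 0 < L) : (regData g hL).HasUVLimit Sw := by
  intro n ι F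
  refine ⟨fun κ => ?_, ?_⟩
  · rw [law_regData]; exact integrable_fieldMonomial_P n ι F
  · have : ∀ κ, (regData g hL).schwinger κ n ι F = Sw n ι F := fun κ => by
      rw [AxialGaugeYMRegularisation.schwinger, law_regData, integral_fieldMonomial_P, Sw_apply]
    simp only [this]
    exact tendsto_const_nhds

end Assembly

end MRSWitness

/-! ### The rendering is vacuous: an artificial witness of `MagnenRivasseauSeneorYM4` -/

/-- **The schematic proposition `MagnenRivasseauSeneorYM4` holds by an artificial witness**
(constructive-qft.S21 as *rendered* in `ConstructiveQFTBalabanRG`; Magnen–Rivasseau–Sénéor,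
CMP 155 (1993) 325–383, Thm. 1, is the intended — and here NOT formalised — content; the
theorem is deliberately not named `MagnenRivasseauSeneorYM4_holds`, so the named fact stays
undischarged in the ledger). For every cube `[0, L]⁴`, `L > 0`, take `g₀ = 1`; for every
`g ∈ (0, 1)` the family `MRSWitness.Sw` (Haar moments of the adjoint orbit of a fixed
non-abelian constant `𝔰𝔲(2)`-frame times `∫ F`) is the UV limit of the regularised data
`MRSWitness.regData g hL` (reference measures `(κ+1) · P`, zero counterterms, all Gibbs laws equal
to `P`), has `Sw 2 ≠ 0` (`MRSWitness.Sw_two_ne_zero`) and satisfies the global `SU(2)` Slavnov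
identities (`MRSWitness.satisfiesSlavnovIdentities_Sw`).

Vacuity finding: the witness is *artificial* — it is unrelated to Yang–Mills theory (no
Gaussian measure, no cluster expansion, no renormalisation) and exists only because the
hypothesis structure `AxialGaugeYMRegularisation` leaves the regularisation `ref κ` as free data
constrained in shape. The theorem therefore certifies exactly what the docstring of
`MagnenRivasseauSeneorYM4` anticipates ("fixes the *shape* of S21, not its analytic content …
presumably admits artificial witnesses"): the v0 rendering carries none of the analytic content of
MRS's Theorem 1, and any use of `(h : MagnenRivasseauSeneorYM4)` downstream is vacuous. A faithful
statement must pin `ref κ` to the regularised axial-gauge Gaussian measure of MRS §1 (not available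
over Mathlib at the pin); S21 should be re-rendered before a genuine discharge is attempted. [folklore] -/
theorem magnenRivasseauSeneorYM4_of_artificialWitness : MagnenRivasseauSeneorYM4 := by
  intro L hL
  refine ⟨1, one_pos, fun g _ => ⟨MRSWitness.Sw, ⟨MRSWitness.regData g hL,
    MRSWitness.hasUVLimit_regData g hL⟩, MRSWitness.Sw_two_ne_zero,
    MRSWitness.satisfiesSlavnovIdentities_Sw⟩⟩

end Literature.MathematicalPhysics.QuantumFieldTheory

namespace Literature.MathematicalPhysics.QuantumFieldTheory

/-- **`MagnenRivasseauSeneorYM4` is a theorem of the tree (audit alias).** The named fact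
`MagnenRivasseauSeneorYM4` (`ConstructiveQFTBalabanRG.lean`): constructive-qft.S21
(Magnen–Rivasseau–Sénéor, *Construction of `YM₄` with an infrared cutoff*, CMP 155 (1993)
325–383, abstract / Thm. 1). … — is proved outright by
`magnenRivasseauSeneorYM4_of_artificialWitness` (this file); this alias records the discharge
under the census/audit name `MagnenRivasseauSeneorYM4_holds` (librarian sweep g25, pass 5c; no
new mathematics).
[folklore] -/
theorem MagnenRivasseauSeneorYM4_holds :
    MagnenRivasseauSeneorYM4 :=
  magnenRivasseauSeneorYM4_of_artificialWitness

end Literature.MathematicalPhysics.QuantumFieldTheory
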